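import Mathlib.Analysis.SpecialFunctions.Log.Deriv
import Mathlib.Analysis.SpecialFunctions.ExpDeriv
import Mathlib.Analysis.SpecialFunctions.Pow.Real
import Mathlib.Analysis.Convex.Deriv
import HarnessLib

/-!
# `Φ₄ = Q'⁴/(I'_A I'_b)²` along one pair weight: first and second derivative, and the `KEY₄` sign

Support file for crux `stmt-CriticalPhenomena-4575` (`NoHeavyLowerTail`), seat `prim-l12-p1` gen 25 (`--supports stmt-CriticalPhenomena-4575`);
companion of `…PortCubeMaxPrinciple` (the cube maximum principle) and the quartic analogue of gen-22's `…ThreePointIsoSexticOnePair`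
(`hasDerivAt_phi`, `onePair_key`, exponents `3, 3/2` there; `4, 2` here).  Memo `run/shared/lean/prim/prim-l12/FROM-prim-l12-p1-g25-PORT-CUBE-MAXPRINCIPLE.md`.
No definitions, no sorries, standard axioms; pure real analysis.

Along the weight `r` of one pair the super-terminal coordinates are affine: `Q(r) = q₀ − r·dq`, `I_A(r) = a₀ − r·da`, `I_b(r) = b₀ − r·db`,
`I_c(r) = c₀ − r·dc`.  With `φ(r) = 4 log Q − 2 log I_A − 2 log I_b` (so `Φ₄ = exp φ` where the three are positive):
* `hasDerivAt_phi4`, `hasDerivAt_phi4_deriv` — `φ'` and `φ''` in closed form;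
* `key4_of_decrements` — `φ'² + φ'' = 4(3X − S)(X − S) + 2(A² + B²)` with `X = dq/Q`, `A = da/I_A`, `B = db/I_b`, `S = A + B`;
* `hasDerivAt_Phi4Line`, `hasDerivAt_Phi4Line_deriv` — the line function `G(s) = exp φ(s) − (c₀ − s·dc)` (= `Φ₄ − I_c` along the pair) has the
  derivative function `g'(s) = exp φ(s)·φ'(s) + dc` near `r`, and `g'` has derivative `exp φ(r)·(φ'(r)² + φ''(r))` at `r`;
* `phi4Line_direction` — the package consumed by `PortCubeMaxPrinciple.cube_maximum_principle`: if `Q, I_A, I_b > 0` at `r` and `KEY₄(r) ≥ 0`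
  then `∃ g' D, 0 ≤ D ∧ (∀ᶠ s near r, HasDerivAt G (g' s) s) ∧ HasDerivAt g' D r`;
* (appendix) `convexOn_Phi4Line_Ico`, `nonpos_of_convexOn_Ico` — Case 1 of THEOREM R (a pair convex on its whole segment `[0,1)`, degenerate at `1`).
-/

namespace Summit.CriticalPhenomena.PercolationContinuityZ3.Theorems.PortCubePhi4Line

open Set Real Filter Topology

/-- Derivative of `φ(r) = 4 log(q₀ − r·dq) − 2 log(a₀ − r·da) − 2 log(b₀ − r·db)`. [this work] -/
theorem hasDerivAt_phi4 {q₀ dq a₀ da b₀ db r : ℝ} (h1 : q₀ - r * dq ≠ 0) (h2 : a₀ - r * da ≠ 0) (h3 : b₀ - r * db ≠ 0) :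
    HasDerivAt (fun r => 4 * log (q₀ - r * dq) - 2 * log (a₀ - r * da) - 2 * log (b₀ - r * db))
      (4 * (-dq / (q₀ - r * dq)) - 2 * (-da / (a₀ - r * da)) - 2 * (-db / (b₀ - r * db))) r := by
  have e1 : HasDerivAt (fun r => q₀ - r * dq) (-dq) r := (hasDerivAt_mul_const dq).const_sub q₀
  have e2 : HasDerivAt (fun r => a₀ - r * da) (-da) r := (hasDerivAt_mul_const da).const_sub a₀
  have e3 : HasDerivAt (fun r => b₀ - r * db) (-db) r := (hasDerivAt_mul_const db).const_sub b₀
  exact (((e1.log h1).const_mul 4).fun_sub ((e2.log h2).const_mul 2)).fun_sub ((e3.log h3).const_mul 2)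

/-- Derivative of `φ'`. [this work] -/
theorem hasDerivAt_phi4_deriv {q₀ dq a₀ da b₀ db r : ℝ} (h1 : q₀ - r * dq ≠ 0) (h2 : a₀ - r * da ≠ 0) (h3 : b₀ - r * db ≠ 0) :
    HasDerivAt (fun r => 4 * (-dq / (q₀ - r * dq)) - 2 * (-da / (a₀ - r * da)) - 2 * (-db / (b₀ - r * db)))
      (4 * (-dq ^ 2 / (q₀ - r * dq) ^ 2) - 2 * (-da ^ 2 / (a₀ - r * da) ^ 2)
        - 2 * (-db ^ 2 / (b₀ - r * db) ^ 2)) r := by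
  have e1 : HasDerivAt (fun r => q₀ - r * dq) (-dq) r := (hasDerivAt_mul_const dq).const_sub q₀
  have e2 : HasDerivAt (fun r => a₀ - r * da) (-da) r := (hasDerivAt_mul_const da).const_sub a₀
  have e3 : HasDerivAt (fun r => b₀ - r * db) (-db) r := (hasDerivAt_mul_const db).const_sub b₀
  have d1 : HasDerivAt (fun r => -dq / (q₀ - r * dq)) (-dq ^ 2 / (q₀ - r * dq) ^ 2) r := by
    have h0 := (hasDerivAt_const r (-dq)).fun_div e1 h1
    simp only [zero_mul, zero_sub] at h0
    refine h0.congr_deriv ?_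
    ring
  have d2 : HasDerivAt (fun r => -da / (a₀ - r * da)) (-da ^ 2 / (a₀ - r * da) ^ 2) r := by
    have h0 := (hasDerivAt_const r (-da)).fun_div e2 h2
    simp only [zero_mul, zero_sub] at h0
    refine h0.congr_deriv ?_
    ring
  have d3 : HasDerivAt (fun r => -db / (b₀ - r * db)) (-db ^ 2 / (b₀ - r * db) ^ 2) r := by
    have h0 := (hasDerivAt_const r (-db)).fun_div e3 h3
    simp only [zero_mul, zero_sub] at h0
    refine h0.congr_deriv ?_
    ring
  exact ((d1.const_mul 4).fun_sub (d2.const_mul 2)).fun_sub (d3.const_mul 2)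

/-- **`KEY₄` in terms of the decrements.**  With `X = dq/Q`, `A = da/I_A`, `B = db/I_b`:
`φ'² + φ'' = 4(3X − (A+B))(X − (A+B)) + 2(A² + B²)` (a formal identity; with Lean's `x/0 = 0` it needs no
non-vanishing hypotheses). [this work] -/
theorem key4_of_decrements (q₀ dq a₀ da b₀ db r : ℝ) :
    (4 * (-dq / (q₀ - r * dq)) - 2 * (-da / (a₀ - r * da)) - 2 * (-db / (b₀ - r * db))) ^ 2 +
      (4 * (-dq ^ 2 / (q₀ - r * dq) ^ 2) - 2 * (-da ^ 2 / (a₀ - r * da) ^ 2) - 2 * (-db ^ 2 / (b₀ - r * db) ^ 2))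
    = 4 * (3 * (dq / (q₀ - r * dq)) - (da / (a₀ - r * da) + db / (b₀ - r * db)))
        * (dq / (q₀ - r * dq) - (da / (a₀ - r * da) + db / (b₀ - r * db)))
      + 2 * ((da / (a₀ - r * da)) ^ 2 + (db / (b₀ - r * db)) ^ 2) := by
  set X : ℝ := dq / (q₀ - r * dq) with hX
  set A : ℝ := da / (a₀ - r * da) with hA
  set B : ℝ := db / (b₀ - r * db) with hB
  have eX : -dq / (q₀ - r * dq) = -X := by rw [hX, neg_div]
  have eA : -da / (a₀ - r * da) = -A := by rw [hA, neg_div]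
  have eB : -db / (b₀ - r * db) = -B := by rw [hB, neg_div]
  have eX2 : -dq ^ 2 / (q₀ - r * dq) ^ 2 = -X ^ 2 := by rw [hX, neg_div, div_pow]
  have eA2 : -da ^ 2 / (a₀ - r * da) ^ 2 = -A ^ 2 := by rw [hA, neg_div, div_pow]
  have eB2 : -db ^ 2 / (b₀ - r * db) ^ 2 = -B ^ 2 := by rw [hB, neg_div, div_pow]
  rw [eX, eA, eB, eX2, eA2, eB2]
  ring

/-- `exp φ = Q⁴/(I_A² I_b²)` where the three affine functions are positive. [this work] -/
theorem exp_phi4_eq {q₀ dq a₀ da b₀ db r : ℝ} (h1 : 0 < q₀ - r * dq) (h2 : 0 < a₀ - r * da) (h3 : 0 < b₀ - r * db) :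
    exp (4 * log (q₀ - r * dq) - 2 * log (a₀ - r * da) - 2 * log (b₀ - r * db)) =
      (q₀ - r * dq) ^ 4 / ((a₀ - r * da) ^ 2 * (b₀ - r * db) ^ 2) := by
  have e : 4 * log (q₀ - r * dq) - 2 * log (a₀ - r * da) - 2 * log (b₀ - r * db) =
      ((4 : ℕ) : ℝ) * log (q₀ - r * dq) - (((2 : ℕ) : ℝ) * log (a₀ - r * da) + ((2 : ℕ) : ℝ) * log (b₀ - r * db)) := by
    push_cast; ring
  rw [e, exp_sub, exp_add, exp_nat_mul, exp_nat_mul, exp_nat_mul, exp_log h1, exp_log h2, exp_log h3]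

/-- Positivity of the three affine functions is an open condition: it holds near `r`. [folklore] -/
theorem eventually_pos3 {q₀ dq a₀ da b₀ db r : ℝ} (h1 : 0 < q₀ - r * dq) (h2 : 0 < a₀ - r * da) (h3 : 0 < b₀ - r * db) :
    ∀ᶠ s in 𝓝 r, 0 < q₀ - s * dq ∧ 0 < a₀ - s * da ∧ 0 < b₀ - s * db := by
  have c1 : Continuous fun s : ℝ => q₀ - s * dq := by fun_prop
  have c2 : Continuous fun s : ℝ => a₀ - s * da := by fun_prop
  have c3 : Continuous fun s : ℝ => b₀ - s * db := by fun_prop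
  filter_upwards [c1.continuousAt.eventually (eventually_gt_nhds h1), c2.continuousAt.eventually (eventually_gt_nhds h2),
    c3.continuousAt.eventually (eventually_gt_nhds h3)] with s hs1 hs2 hs3 using ⟨hs1, hs2, hs3⟩

/-- **First derivative of the line function** `G(s) = exp φ(s) − (c₀ − s·dc)` (`= Φ₄ − I_c` along the pair): near `r`,
`HasDerivAt G (exp φ(s)·φ'(s) + dc) s`. [this work] -/
theorem hasDerivAt_Phi4Line {q₀ dq a₀ da b₀ db c₀ dc r : ℝ} (h1 : 0 < q₀ - r * dq) (h2 : 0 < a₀ - r * da) (h3 : 0 < b₀ - r * db) :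
    ∀ᶠ s in 𝓝 r, HasDerivAt
      (fun s => exp (4 * log (q₀ - s * dq) - 2 * log (a₀ - s * da) - 2 * log (b₀ - s * db)) - (c₀ - s * dc))
      (exp (4 * log (q₀ - s * dq) - 2 * log (a₀ - s * da) - 2 * log (b₀ - s * db)) *
          (4 * (-dq / (q₀ - s * dq)) - 2 * (-da / (a₀ - s * da)) - 2 * (-db / (b₀ - s * db))) + dc) s := by
  filter_upwards [eventually_pos3 h1 h2 h3] with s hs
  obtain ⟨hs1, hs2, hs3⟩ := hs
  have hl : HasDerivAt (fun s : ℝ => c₀ - s * dc) (-dc) s := (hasDerivAt_mul_const dc).const_sub c₀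
  exact ((hasDerivAt_phi4 hs1.ne' hs2.ne' hs3.ne').exp).fun_sub hl |>.congr_deriv (by ring)

/-- **Second derivative of the line function at `r`**: the derivative function `g'(s) = exp φ(s)·φ'(s) + dc` has derivative
`exp φ(r)·(φ'(r)² + φ''(r))` at `r`. [this work] -/
theorem hasDerivAt_Phi4Line_deriv {q₀ dq a₀ da b₀ db dc r : ℝ} (h1 : 0 < q₀ - r * dq) (h2 : 0 < a₀ - r * da) (h3 : 0 < b₀ - r * db) :
    HasDerivAt
      (fun s => exp (4 * log (q₀ - s * dq) - 2 * log (a₀ - s * da) - 2 * log (b₀ - s * db)) *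
          (4 * (-dq / (q₀ - s * dq)) - 2 * (-da / (a₀ - s * da)) - 2 * (-db / (b₀ - s * db))) + dc)
      (exp (4 * log (q₀ - r * dq) - 2 * log (a₀ - r * da) - 2 * log (b₀ - r * db)) *
        ((4 * (-dq / (q₀ - r * dq)) - 2 * (-da / (a₀ - r * da)) - 2 * (-db / (b₀ - r * db))) ^ 2 +
          (4 * (-dq ^ 2 / (q₀ - r * dq) ^ 2) - 2 * (-da ^ 2 / (a₀ - r * da) ^ 2) - 2 * (-db ^ 2 / (b₀ - r * db) ^ 2)))) r := by
  have hE := (hasDerivAt_phi4 h1.ne' h2.ne' h3.ne').exp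
  have hP := hasDerivAt_phi4_deriv h1.ne' h2.ne' h3.ne'
  have hprod := hE.mul hP
  have := hprod.add_const dc
  refine this.congr_deriv ?_
  ring

/-- **The convex-direction package for the cube maximum principle.**  If `Q, I_A, I_b > 0` at `r` and `KEY₄(r) ≥ 0` (in the form
`0 ≤ φ'(r)² + φ''(r)`), then the line function `G = exp φ − I_c` admits a derivative function near `r` whose derivative `D` at `r` is `≥ 0` —
exactly the hypothesis `hdir` of `PortCubeMaxPrinciple.cube_maximum_principle` for this coordinate direction. [this work] -/
theorem phi4Line_direction {q₀ dq a₀ da b₀ db c₀ dc r : ℝ} (h1 : 0 < q₀ - r * dq) (h2 : 0 < a₀ - r * da) (h3 : 0 < b₀ - r * db)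
    (hkey : 0 ≤ (4 * (-dq / (q₀ - r * dq)) - 2 * (-da / (a₀ - r * da)) - 2 * (-db / (b₀ - r * db))) ^ 2 +
      (4 * (-dq ^ 2 / (q₀ - r * dq) ^ 2) - 2 * (-da ^ 2 / (a₀ - r * da) ^ 2) - 2 * (-db ^ 2 / (b₀ - r * db) ^ 2))) :
    ∃ g' : ℝ → ℝ, ∃ D : ℝ, 0 ≤ D ∧
      (∀ᶠ s in 𝓝 r, HasDerivAt
        (fun s => exp (4 * log (q₀ - s * dq) - 2 * log (a₀ - s * da) - 2 * log (b₀ - s * db)) - (c₀ - s * dc)) (g' s) s) ∧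
      HasDerivAt g' D r :=
  ⟨_, _, mul_nonneg (exp_pos _).le hkey, hasDerivAt_Phi4Line h1 h2 h3, hasDerivAt_Phi4Line_deriv h1 h2 h3⟩

/-- **`XS` along the pair ⟹ convex direction** (`dq ≥ 0`, `Q·(da·I_b + db·I_A) ≤ dq·I_A·I_b`): then `KEY₄(r) ≥ 0`.  Covers every TERMINAL
pair at the port (memo §2). [this work] -/
theorem key4_nonneg_of_XS {q₀ dq a₀ da b₀ db r : ℝ} (hQ : 0 < q₀ - r * dq) (hA : 0 < a₀ - r * da) (hB : 0 < b₀ - r * db)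
    (hdq : 0 ≤ dq) (hXS : (q₀ - r * dq) * (da * (b₀ - r * db) + db * (a₀ - r * da)) ≤ dq * (a₀ - r * da) * (b₀ - r * db)) :
    0 ≤ (4 * (-dq / (q₀ - r * dq)) - 2 * (-da / (a₀ - r * da)) - 2 * (-db / (b₀ - r * db))) ^ 2 +
      (4 * (-dq ^ 2 / (q₀ - r * dq) ^ 2) - 2 * (-da ^ 2 / (a₀ - r * da) ^ 2) - 2 * (-db ^ 2 / (b₀ - r * db) ^ 2)) := by
  rw [key4_of_decrements]
  set X : ℝ := dq / (q₀ - r * dq) with hX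
  set A : ℝ := da / (a₀ - r * da) with hAdef
  set B : ℝ := db / (b₀ - r * db) with hBdef
  have hX0 : 0 ≤ X := div_nonneg hdq hQ.le
  have hS : A + B ≤ X := by
    rw [hX, hAdef, hBdef, div_add_div _ _ hA.ne' hB.ne', div_le_div_iff₀ (mul_pos hA hB) hQ]
    calc (da * (b₀ - r * db) + (a₀ - r * da) * db) * (q₀ - r * dq)
        = (q₀ - r * dq) * (da * (b₀ - r * db) + db * (a₀ - r * da)) := by ring
      _ ≤ dq * (a₀ - r * da) * (b₀ - r * db) := hXS
      _ = dq * ((a₀ - r * da) * (b₀ - r * db)) := by ring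
  have h1 : 0 ≤ 3 * X - (A + B) := by linarith
  have h2 : 0 ≤ X - (A + B) := by linarith
  have h3 : 0 ≤ 4 * (3 * X - (A + B)) * (X - (A + B)) := by positivity
  nlinarith [sq_nonneg A, sq_nonneg B]

/-! ## Appendix (gen 25, Case 1 of THEOREM R): the one-dimensional chord along a pair that is convex on its whole segment

Along a TERMINAL port pair (or a pair to a cut vertex of every `s–a` route) `KEY₄ ≥ 0` holds at every point of the segment, the three
affine functions are positive on `[0,1)` and degenerate at `1`, where `Φ₄ → 0` and `I_c → 0`.  The next two lemmas are the analysis of that case: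
convexity on `[0,1)` from the pointwise sign of `KEY₄`, and `f ≤ 0` on `[0,1)` from `f(0) ≤ 0` and a limit `≤ 0` at `1`
(`run/shared/lean/prim/prim-l12/prim-l12-p1/PROOF-PORT-CUBE-gen25.md`, Case 1). -/

/-- **Convexity of the line function on `[0,1)`** from positivity of `Q, I_A, I_b` and `KEY₄ ≥ 0` at every point of `[0,1)`. [this work] -/
theorem convexOn_Phi4Line_Ico {q₀ dq a₀ da b₀ db c₀ dc : ℝ}
    (hpos : ∀ t ∈ Ico (0 : ℝ) 1, 0 < q₀ - t * dq ∧ 0 < a₀ - t * da ∧ 0 < b₀ - t * db)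
    (hkey : ∀ t ∈ Ico (0 : ℝ) 1, 0 ≤ (4 * (-dq / (q₀ - t * dq)) - 2 * (-da / (a₀ - t * da)) - 2 * (-db / (b₀ - t * db))) ^ 2 +
      (4 * (-dq ^ 2 / (q₀ - t * dq) ^ 2) - 2 * (-da ^ 2 / (a₀ - t * da) ^ 2) - 2 * (-db ^ 2 / (b₀ - t * db) ^ 2))) :
    ConvexOn ℝ (Ico (0 : ℝ) 1)
      (fun s => exp (4 * log (q₀ - s * dq) - 2 * log (a₀ - s * da) - 2 * log (b₀ - s * db)) - (c₀ - s * dc)) := by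
  refine convexOn_of_hasDerivWithinAt2_nonneg (convex_Ico 0 1)
    (f' := fun s => exp (4 * log (q₀ - s * dq) - 2 * log (a₀ - s * da) - 2 * log (b₀ - s * db)) *
          (4 * (-dq / (q₀ - s * dq)) - 2 * (-da / (a₀ - s * da)) - 2 * (-db / (b₀ - s * db))) + dc)
    (f'' := fun s => exp (4 * log (q₀ - s * dq) - 2 * log (a₀ - s * da) - 2 * log (b₀ - s * db)) *
        ((4 * (-dq / (q₀ - s * dq)) - 2 * (-da / (a₀ - s * da)) - 2 * (-db / (b₀ - s * db))) ^ 2 +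
          (4 * (-dq ^ 2 / (q₀ - s * dq) ^ 2) - 2 * (-da ^ 2 / (a₀ - s * da) ^ 2) - 2 * (-db ^ 2 / (b₀ - s * db) ^ 2))))
    ?_ ?_ ?_ ?_
  · intro t ht
    obtain ⟨h1, h2, h3⟩ := hpos t ht
    exact ((hasDerivAt_Phi4Line (c₀ := c₀) (dc := dc) h1 h2 h3).self_of_nhds).continuousAt.continuousWithinAt
  · intro t ht
    rw [interior_Ico] at ht
    obtain ⟨h1, h2, h3⟩ := hpos t (Ioo_subset_Ico_self ht)
    exact ((hasDerivAt_Phi4Line (c₀ := c₀) (dc := dc) h1 h2 h3).self_of_nhds).hasDerivWithinAt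
  · intro t ht
    rw [interior_Ico] at ht
    obtain ⟨h1, h2, h3⟩ := hpos t (Ioo_subset_Ico_self ht)
    exact (hasDerivAt_Phi4Line_deriv (dc := dc) h1 h2 h3).hasDerivWithinAt
  · intro t ht
    rw [interior_Ico] at ht
    have ht' := Ioo_subset_Ico_self ht
    exact mul_nonneg (exp_pos _).le (hkey t ht')

/-- **Chord-to-the-endpoint bound.**  If `f` is convex on `[0,1)`, `f 0 ≤ 0`, and `f(τ) → L ≤ 0` as `τ → 1⁻`, then `f ≤ 0` on `[0,1)`
(`f t ≤ (1 − t/τ) f 0 + (t/τ) f τ` for `t < τ < 1`, and let `τ → 1`). [this work] -/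
theorem nonpos_of_convexOn_Ico {f : ℝ → ℝ} (hconv : ConvexOn ℝ (Ico (0 : ℝ) 1) f) (h0 : f 0 ≤ 0) {L : ℝ} (hL : L ≤ 0)
    (hlim : Tendsto f (𝓝[<] (1 : ℝ)) (𝓝 L)) : ∀ t ∈ Ico (0 : ℝ) 1, f t ≤ 0 := by
  intro t ht
  obtain ⟨ht0, ht1⟩ := ht
  -- the chord bound, for `τ ∈ (t, 1)` with `τ > 0`
  have chord : ∀ τ : ℝ, t < τ → 0 < τ → τ < 1 → f t ≤ (1 - t / τ) * f 0 + (t / τ) * f τ := by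
    intro τ hτt hτ0 hτ1
    have hw0 : 0 ≤ 1 - t / τ := by
      rw [sub_nonneg, div_le_one hτ0]; exact hτt.le
    have hw1 : 0 ≤ t / τ := div_nonneg ht0 hτ0.le
    have hmem0 : (0 : ℝ) ∈ Ico (0 : ℝ) 1 := ⟨le_rfl, zero_lt_one⟩
    have hmemτ : τ ∈ Ico (0 : ℝ) 1 := ⟨hτ0.le, hτ1⟩
    have h := hconv.2 hmem0 hmemτ hw0 hw1 (by ring)
    have e : (1 - t / τ) • (0 : ℝ) + (t / τ) • τ = t := by
      rw [smul_eq_mul, smul_eq_mul, mul_zero, zero_add, div_mul_cancel₀ t hτ0.ne']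
    rw [e] at h
    simpa only [smul_eq_mul] using h
  -- pass to the limit `τ → 1⁻`
  have hg : Tendsto (fun τ : ℝ => (1 - t / τ) * f 0 + (t / τ) * f τ) (𝓝[<] (1 : ℝ)) (𝓝 ((1 - t / 1) * f 0 + (t / 1) * L)) := by
    have hid : Tendsto (fun τ : ℝ => τ) (𝓝[<] (1 : ℝ)) (𝓝 1) := tendsto_nhdsWithin_of_tendsto_nhds tendsto_id
    have hdiv : Tendsto (fun τ : ℝ => t / τ) (𝓝[<] (1 : ℝ)) (𝓝 (t / 1)) := tendsto_const_nhds.div hid one_ne_zero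
    exact ((tendsto_const_nhds.sub hdiv).mul tendsto_const_nhds).add (hdiv.mul hlim)
  have hev : ∀ᶠ τ in 𝓝[<] (1 : ℝ), f t ≤ (1 - t / τ) * f 0 + (t / τ) * f τ := by
    have h1 : ∀ᶠ τ in 𝓝[<] (1 : ℝ), t < τ := by
      have : Ioo t 1 ∈ 𝓝[<] (1 : ℝ) := Ioo_mem_nhdsLT ht1
      filter_upwards [this] with τ hτ using hτ.1
    have h2 : ∀ᶠ τ in 𝓝[<] (1 : ℝ), τ < 1 := by
      filter_upwards [self_mem_nhdsWithin] with τ hτ using hτ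
    filter_upwards [h1, h2] with τ hτt hτ1 using chord τ hτt (lt_of_le_of_lt ht0 hτt) hτ1
  have hle := le_of_tendsto_of_tendsto tendsto_const_nhds hg hev
  have : (1 - t / 1) * f 0 + t / 1 * L ≤ 0 := by
    rw [div_one]
    nlinarith
  linarith

end Summit.CriticalPhenomena.PercolationContinuityZ3.Theorems.PortCubePhi4Line
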